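import Literature.Geometry.Kaehler.ComplexTorusHypersurfaceClassPointCounts
import HarnessLib

/-!
# Divisor classes of an abelian variety are determined by their degrees on `ρ` test curves, and curve
# classes by their intersection numbers with `ρ` test hypersurfaces (`ρ` the Picard number)

Layer `Literature/Geometry/Kaehler`, namespace `Literature.Geometry.Kaehler.ComplexTorus`; lane
`lit-hodgefound`, seat p07 (generation 42), programme «NUMERICAL EQUIVALENCE», file 41. Sequel of files 38–39
(`ComplexTorusHomologicalNumericalEquivalence`: hom = num for divisor and `1`-cycle classes of an abelian
variety; `ComplexTorusHypersurfaceClassPointCounts`: `∫_C [D] = sign(e) · #(C ∩ (D − t))` for a.e. `t`).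
Theorems only (no definition, no named fact; net debt `0`).

THE POINT. `NS(X) ⊗ ℚ = H²_Hodge(X) = B¹` is finite-dimensional, of dimension the Picard number
`ρ(X) = dim_ℚ B¹ = dim_ℚ B^{g-1}` (hard Lefschetz), and `B^{g-1} = A^{g-1}` is spanned by the classes of
the irreducible analytic curves (Lefschetz `(1,1)` + hard Lefschetz, `analyticClasses_eq_span_irreducible`); a
spanning set contains a basis (`exists_linearIndependent`). Hence there are irreducible curves
`C₁, …, C_ρ ⊆ X` — as many as the Picard number — such that a divisor class (a Hodge class of degree `2`, a
Néron–Severi class, the class of a hypersurface) is ZERO as soon as its degrees `∫_{C_k} x` on these `ρ`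
curves vanish; two hypersurfaces have the same class iff they have the same intersection numbers with
`C₁, …, C_ρ`, iff their general translates meet each `C_k` in the same number of points. Dually there are
`ρ` irreducible hypersurfaces testing the classes of curves. (Fulton, Example 19.3.3 and §19.3.1:
`N¹(X) = NS(X) ⊗ ℚ` is finite-dimensional and dual to `N₁(X)`; Hartshorne 1970, p. 28: numerical
equivalence of divisors is tested on curves; Lange 2023, §6.2.5 Exercise (10): hom = num on an abelian
variety.)

## Contents

* §1 **`IsAbelianVariety.exists_testCurves`** — `ρ = dim_ℚ H²_Hodge(X)` irreducible curves `C_k` with: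
  `x ∈ H²_Hodge(X)` and `∫_{C_k} x = 0` for all `k` imply `x = 0`; corollaries
  `IsAbelianVariety.exists_testCurves_isNSForm` (Néron–Severi classes),
  **`IsAbelianVariety.exists_testCurves_hypersurface`** (`[D₁] = [D₂] ⟺ ∫_{C_k} [D₁] = ∫_{C_k} [D₂]` for the
  `ρ` test curves), **`IsAbelianVariety.exists_testCurves_hypersurface_ncard`** (iff the general translates
  of `D₁`, `D₂` meet each `C_k` in the same number of points).
* §2 **`IsAbelianVariety.exists_testHypersurfaces`** — `ρ` irreducible hypersurfaces `D_k` with: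
  `y ∈ H^{2g-2}_Hodge(X)` and `∫_{D_k} y = 0` for all `k` imply `y = 0`;
  `IsAbelianVariety.exists_testHypersurfaces_curve` (`[C₁] = [C₂] ⟺ ∫_{D_k} [C₁] = ∫_{D_k} [C₂]`).

## References

* [Fulton1998] W. Fulton, *Intersection Theory*, 2nd ed., Springer 1998, §19.3.1 and Example 19.3.3.
* [Hartshorne1970] R. Hartshorne, *Ample Subvarieties of Algebraic Varieties*, LNM 156 (1970), Ch. I §6 (p. 28).
* [Lange2023AbelianVarietiesComplex] H. Lange, *Abelian Varieties over the Complex Numbers*, Springer 2023,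
  §6.2.5 Exercise (10), §7.3.2 (1) (`dim H^{2p}_Hodge = dim H^{2g-2p}_Hodge`), §7.3.3 Exercise (2).
* [BrosnanFangNiePearlstein2009] P. Brosnan, H. Fang, Z. Nie, G. Pearlstein, *Singularities of admissible
  normal functions*, Invent. Math. 177 (2009), §6 (6.1).
-/

noncomputable section

open scoped Manifold Topology Pointwise
open MeasureTheory Set Function Filter Module

namespace Literature.Geometry.Kaehler

namespace ComplexTorus

universe u

variable {ι : Type*} [Fintype ι] [DecidableEq ι] {E : Type u} [NormedAddCommGroup E] [InnerProductSpace ℂ E]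
  [FiniteDimensional ℂ E] [MeasurableSpace E] [BorelSpace E] (Φ : (ι → ℝ) ≃L[ℝ] E) {g : ℕ}
  (e : Fin (2 * g) ≃ ι)

/-- **A spanning family of irreducible subvariety classes contains a basis of the Hodge classes, and the
pairing against it detects zero.** For a polarised torus with `p + q = g` and `A^q = B^q`: there are
`dim_ℚ Bᵖ` irreducible closed analytic subsets `Z_k` of dimension `p` such that a Hodge class `x ∈ Bᵖ` with
`∫_{Z_k} x = 0` for all `k` is `0`. [cite: Lange2023AbelianVarietiesComplex, §6.2.5 Exercise (10) and §7.3.2 (1)]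
[cite: BrosnanFangNiePearlstein2009, §6 (6.1)] -/
theorem IsRiemannForm.exists_fintype_forall_analyticCyclePeriod_eq_zero_imp {η : E [⋀^Fin 2]→L[ℝ] ℝ}
    (hη : IsRiemannForm Φ η) {p q : ℕ} (hpq : p + q = g) (h2 : 2 * p + 2 * q = 2 * g)
    (hA : analyticClasses Φ e q = hodgeClasses Φ q) :
    ∃ (κ : Type u) (_ : Fintype κ) (Z : κ → Set (ComplexTorus Φ)) (hZ : ∀ k, HasPureDim 𝓘(ℂ, E) (Z k) p),
      Fintype.card κ = finrank ℚ (hodgeClasses Φ p) ∧ (∀ k, IsIrreducibleAnalyticSet 𝓘(ℂ, E) (Z k)) ∧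
        ∀ x ∈ hodgeClasses Φ p, (∀ k, analyticCyclePeriod Φ (hZ k) x = 0) → x = 0 := by
  classical
  have hg : finrank ℂ E = g := finrank_eq_of_finTwoMulEquiv Φ e
  haveI : FiniteDimensional ℚ (hodgeClasses Φ q) := finiteDimensional_hodgeClassesIn Φ _ _
  -- the irreducible classes, read inside the `ℚ`-space `B^q`
  let S' : Set (hodgeClasses Φ q) := {v | ∃ (Z : Set (ComplexTorus Φ)) (hZ : HasPureDim 𝓘(ℂ, E) Z p),
    IsIrreducibleAnalyticSet 𝓘(ℂ, E) Z ∧ (v : E [⋀^Fin (2 * q)]→L[ℝ] ℂ) = analyticCycleClass Φ e h2 hZ}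
  -- `span S' = ⊤`: every Hodge class of degree `2q` is a `ℚ`-combination of irreducible classes
  have hspanS : Submodule.span ℚ S' = ⊤ := by
    refine eq_top_iff.2 fun v _ ↦ ?_
    have hv : (v : E [⋀^Fin (2 * q)]→L[ℝ] ℂ) ∈ analyticClasses Φ e q := by rw [hA]; exact v.2
    rw [analyticClasses_eq_span_irreducible Φ e h2] at hv
    have himage : {γ : E [⋀^Fin (2 * q)]→L[ℝ] ℂ | ∃ (Z : Set (ComplexTorus Φ))
        (_ : IsIrreducibleAnalyticSet 𝓘(ℂ, E) Z) (hZ : HasPureDim 𝓘(ℂ, E) Z p),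
          γ = analyticCycleClass Φ e h2 hZ} ⊆ (hodgeClasses Φ q).subtype '' S' := by
      rintro _ ⟨Z, hZi, hZ, rfl⟩
      have hmem : analyticCycleClass Φ e h2 hZ ∈ hodgeClasses Φ q := by
        rw [← hA]; exact analyticCycleClass_mem_analyticClasses Φ e h2 hZ
      exact ⟨⟨_, hmem⟩, ⟨Z, hZ, hZi, rfl⟩, rfl⟩
    have hv' : (v : E [⋀^Fin (2 * q)]→L[ℝ] ℂ) ∈
        Submodule.map (hodgeClasses Φ q).subtype (Submodule.span ℚ S') := by
      rw [Submodule.map_span]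
      exact Submodule.span_mono himage hv
    obtain ⟨w, hw, hwv⟩ := hv'
    rwa [show w = v from Subtype.ext hwv] at hw
  -- a basis of `B^q` inside `S'`
  obtain ⟨b, hbS, hbspan, hbli⟩ := exists_linearIndependent ℚ S'
  have hbfin : b.Finite := hbli.setFinite
  haveI : Fintype b := hbfin.fintype
  have hcard : Fintype.card b = finrank ℚ (hodgeClasses Φ p) := by
    rw [hη.finrank_hodgeClasses_eq_of_add_eq Φ (show p + q = finrank ℂ E by omega), ← Set.toFinset_card,
      ← finrank_span_set_eq_card (R := ℚ) (show LinearIndepOn ℚ id b from hbli), hbspan, hspanS, finrank_top]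
  -- the test subvarieties
  have hcurve : ∀ v : b, ∃ (Z : Set (ComplexTorus Φ)) (hZ : HasPureDim 𝓘(ℂ, E) Z p),
      IsIrreducibleAnalyticSet 𝓘(ℂ, E) Z ∧
        ((v : hodgeClasses Φ q) : E [⋀^Fin (2 * q)]→L[ℝ] ℂ) = analyticCycleClass Φ e h2 hZ :=
    fun v ↦ hbS v.2
  choose Z hZ hZi hZeq using hcurve
  refine ⟨b, inferInstance, Z, hZ, hcard, hZi, fun x hx h0 ↦ ?_⟩
  -- `⟨x, ·⟩` vanishes on `b`, hence on `span b = B^q`, hence on every irreducible class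
  have hvan : ∀ v : hodgeClasses Φ q, poincarePairing Φ e h2 x (v : E [⋀^Fin (2 * q)]→L[ℝ] ℂ) = 0 := by
    intro v
    have hv : v ∈ Submodule.span ℚ b := by rw [hbspan, hspanS]; trivial
    induction hv using Submodule.span_induction with
    | mem w hw =>
      rw [hZeq ⟨w, hw⟩, poincarePairing_analyticCycleClass]
      exact h0 ⟨w, hw⟩
    | zero => rw [Submodule.coe_zero, map_zero]
    | add w w' _ _ hw hw' => rw [Submodule.coe_add, map_add, hw, hw', add_zero]
    | smul c w _ hw =>
      rw [Submodule.coe_smul, ← Rat.cast_smul_eq_qsmul ℂ c, map_smul, hw, smul_zero]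
  refine hη.eq_zero_of_mem_hodgeClasses_of_forall_poincarePairing_analyticCycleClass_eq_zero Φ e hpq h2 hA hx
    fun Z₀ hZ₀ _ ↦ ?_
  have hmem : analyticCycleClass Φ e h2 hZ₀ ∈ hodgeClasses Φ q := by
    rw [← hA]; exact analyticCycleClass_mem_analyticClasses Φ e h2 hZ₀
  exact hvan ⟨_, hmem⟩

/-! ### §1 `ρ` test curves determine the divisor classes of an abelian variety -/

section TestCurves

variable {q : ℕ}

/-- **`ρ(X)` TEST CURVES.** On an abelian variety `X` of dimension `g = q + 1` there are irreducible analytic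
curves `C₁, …, C_ρ`, `ρ = dim_ℚ H²_Hodge(X)` the Picard number, such that every Hodge class `x ∈ H²_Hodge(X)`
(`= NS(X) ⊗ ℚ`) with `∫_{C_k} x = 0` for `k = 1, …, ρ` is `0` (the curve classes span `H^{2g-2}_Hodge`, of
dimension `ρ` by hard Lefschetz; a spanning set contains a basis; the pairing with `H²_Hodge` is perfect).
[cite: Fulton1998, §19.3.1 and Example 19.3.3] [cite: Lange2023AbelianVarietiesComplex, §6.2.5 Exercise (10) and §7.3.2 (1)]
[cite: Hartshorne1970, Ch. I §6 (p. 28)] -/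
theorem IsAbelianVariety.exists_testCurves (hX : IsAbelianVariety Φ) (e : Fin (2 * g) ≃ ι) (hq : 1 + q = g) :
    ∃ (κ : Type u) (_ : Fintype κ) (C : κ → Set (ComplexTorus Φ)) (hC : ∀ k, HasPureDim 𝓘(ℂ, E) (C k) 1),
      Fintype.card κ = finrank ℚ (hodgeClasses Φ 1) ∧ (∀ k, IsIrreducibleAnalyticSet 𝓘(ℂ, E) (C k)) ∧
        ∀ x ∈ hodgeClasses Φ 1, (∀ k, analyticCyclePeriod Φ (hC k) x = 0) → x = 0 := by
  obtain ⟨η, hη⟩ := hX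
  have hg : finrank ℂ E = q + 1 := by rw [finrank_eq_of_finTwoMulEquiv Φ e]; omega
  exact hη.exists_fintype_forall_analyticCyclePeriod_eq_zero_imp Φ e hq (by omega)
    (IsAbelianVariety.analyticClasses_eq_hodgeClasses_of_finrank_eq_succ Φ e ⟨η, hη⟩ hg)

/-- **Néron–Severi classes are determined by their degrees on the `ρ` test curves**: `η₁ = η₂` in `NS(X)` iff
`∫_{C_k} η₁ = ∫_{C_k} η₂` for `k = 1, …, ρ`. [cite: Fulton1998, §19.3.1 and Example 19.3.3]
[cite: Hartshorne1970, Ch. I §6 (p. 28)] -/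
theorem IsAbelianVariety.exists_testCurves_isNSForm (hX : IsAbelianVariety Φ) (e : Fin (2 * g) ≃ ι)
    (hq : 1 + q = g) :
    ∃ (κ : Type u) (_ : Fintype κ) (C : κ → Set (ComplexTorus Φ)) (hC : ∀ k, HasPureDim 𝓘(ℂ, E) (C k) 1),
      Fintype.card κ = finrank ℚ (hodgeClasses Φ 1) ∧ (∀ k, IsIrreducibleAnalyticSet 𝓘(ℂ, E) (C k)) ∧
        ∀ {η₁ η₂ : E [⋀^Fin 2]→L[ℝ] ℝ}, IsNSForm Φ η₁ → IsNSForm Φ η₂ →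
          (η₁ = η₂ ↔ ∀ k, analyticCyclePeriod Φ (hC k) (ofRealForm η₁) = analyticCyclePeriod Φ (hC k) (ofRealForm η₂)) := by
  obtain ⟨κ, _, C, hC, hcard, hCi, h⟩ := hX.exists_testCurves Φ e hq
  refine ⟨κ, inferInstance, C, hC, hcard, hCi, fun {η₁ η₂} hη₁ hη₂ ↦ ⟨fun h12 k ↦ by rw [h12], fun h12 ↦ ?_⟩⟩
  rw [← sub_eq_zero]
  have hNS : IsNSForm Φ (η₁ - η₂) :=
    (mem_neronSeveriGroup_iff Φ).1 (sub_mem ((mem_neronSeveriGroup_iff Φ).2 hη₁)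
      ((mem_neronSeveriGroup_iff Φ).2 hη₂))
  have h0 := h (ofRealForm (η₁ - η₂)) (ofRealForm_mem_hodgeClasses_one Φ hNS) fun k ↦ by
    rw [sub_eq_add_neg, ofRealForm_add, ofRealForm_neg, map_add, map_neg, h12 k, add_neg_cancel]
  exact ofRealForm_injective (h0.trans ofRealForm_zero.symm)

/-- **The class of a hypersurface is determined by its intersection numbers with the `ρ` test curves**:
for closed analytic hypersurfaces `D₁, D₂`, `[D₁]_e = [D₂]_e ⟺ ∫_{C_k} [D₁]_e = ∫_{C_k} [D₂]_e` for
`k = 1, …, ρ`. [cite: Hartshorne1970, Ch. I §6 (p. 28)] [cite: Fulton1998, §19.3.1 and Example 19.3.3]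
[cite: Lange2023AbelianVarietiesComplex, §6.2.5 Exercise (10)] -/
theorem IsAbelianVariety.exists_testCurves_hypersurface (hX : IsAbelianVariety Φ) (hq : 1 + q = g)
    (hD' : 2 * q + 2 * 1 = 2 * g) :
    ∃ (κ : Type u) (_ : Fintype κ) (C : κ → Set (ComplexTorus Φ)) (hC : ∀ k, HasPureDim 𝓘(ℂ, E) (C k) 1),
      Fintype.card κ = finrank ℚ (hodgeClasses Φ 1) ∧ (∀ k, IsIrreducibleAnalyticSet 𝓘(ℂ, E) (C k)) ∧
        ∀ {D₁ D₂ : Set (ComplexTorus Φ)} (hD₁ : HasPureDim 𝓘(ℂ, E) D₁ q) (hD₂ : HasPureDim 𝓘(ℂ, E) D₂ q),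
          analyticCycleClass Φ e hD' hD₁ = analyticCycleClass Φ e hD' hD₂ ↔
            ∀ k, analyticCyclePeriod Φ (hC k) (analyticCycleClass Φ e hD' hD₁) =
              analyticCyclePeriod Φ (hC k) (analyticCycleClass Φ e hD' hD₂) := by
  obtain ⟨κ, _, C, hC, hcard, hCi, h⟩ := hX.exists_testCurves Φ e hq
  refine ⟨κ, inferInstance, C, hC, hcard, hCi, fun hD₁ hD₂ ↦ ⟨fun h12 k ↦ by rw [h12], fun h12 ↦ ?_⟩⟩
  rw [← sub_eq_zero]
  refine h _ (Submodule.sub_mem _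
    (analyticClasses_le_hodgeClasses Φ e 1 (analyticCycleClass_mem_analyticClasses Φ e hD' hD₁))
    (analyticClasses_le_hodgeClasses Φ e 1 (analyticCycleClass_mem_analyticClasses Φ e hD' hD₂))) fun k ↦ ?_
  rw [map_sub, h12 k, sub_self]

/-- **The class of a hypersurface is determined by the number of points in which its general translates meet
the `ρ` test curves**: `[D₁]_e = [D₂]_e ⟺` for each `k`, `#(C_k ∩ (D₁ − t)) = #(C_k ∩ (D₂ − t))` for
almost every `t`. [cite: Fulton1998, Example 11.4.5, §19.3.1 and Example 19.3.3] [cite: Hartshorne1970, Ch. I §6 (p. 28)] -/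
theorem IsAbelianVariety.exists_testCurves_hypersurface_ncard (hX : IsAbelianVariety Φ) (hq : 1 + q = g)
    (hD' : 2 * q + 2 * 1 = 2 * g) :
    ∃ (κ : Type u) (_ : Fintype κ) (C : κ → Set (ComplexTorus Φ)) (_ : ∀ k, HasPureDim 𝓘(ℂ, E) (C k) 1),
      Fintype.card κ = finrank ℚ (hodgeClasses Φ 1) ∧ (∀ k, IsIrreducibleAnalyticSet 𝓘(ℂ, E) (C k)) ∧
        ∀ {D₁ D₂ : Set (ComplexTorus Φ)} (hD₁ : HasPureDim 𝓘(ℂ, E) D₁ q) (hD₂ : HasPureDim 𝓘(ℂ, E) D₂ q),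
          analyticCycleClass Φ e hD' hD₁ = analyticCycleClass Φ e hD' hD₂ ↔
            ∀ k, ∀ᵐ t ∂(volume : Measure (ComplexTorus Φ)),
              (C k ∩ (fun x ↦ x + t) ⁻¹' D₁).ncard = (C k ∩ (fun x ↦ x + t) ⁻¹' D₂).ncard := by
  have hC' : 2 * 1 + 2 * q = 2 * g := by omega
  have hsign : (orientationSign Φ e : ℂ) ≠ 0 := by
    rcases orientationSign_eq_or Φ e with hs | hs <;> rw [hs] <;> norm_num
  obtain ⟨κ, _, C, hC, hcard, hCi, h⟩ := hX.exists_testCurves_hypersurface Φ e hq hD'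
  refine ⟨κ, inferInstance, C, hC, hcard, hCi, fun {D₁ D₂} hD₁ hD₂ ↦ ?_⟩
  rw [h hD₁ hD₂]
  refine forall_congr' fun k ↦ ⟨fun hk ↦ ?_, fun hk ↦ ?_⟩
  · filter_upwards [ae_finite_and_analyticCyclePeriod_eq_orientationSign_mul_ncard Φ e hq hC' hD' (hC k) hD₁,
      ae_finite_and_analyticCyclePeriod_eq_orientationSign_mul_ncard Φ e hq hC' hD' (hC k) hD₂] with t h₁ h₂
    have h12 : (orientationSign Φ e : ℂ) * ((C k ∩ (fun x ↦ x + t) ⁻¹' D₁).ncard : ℂ) =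
        (orientationSign Φ e : ℂ) * ((C k ∩ (fun x ↦ x + t) ⁻¹' D₂).ncard : ℂ) := by
      rw [← h₁.2, ← h₂.2, hk]
    exact_mod_cast mul_left_cancel₀ hsign h12
  · obtain ⟨t, ht, h₁, h₂⟩ := (hk.and
      ((ae_finite_and_analyticCyclePeriod_eq_orientationSign_mul_ncard Φ e hq hC' hD' (hC k) hD₁).and
        (ae_finite_and_analyticCyclePeriod_eq_orientationSign_mul_ncard Φ e hq hC' hD' (hC k) hD₂))).exists
    rw [h₁.2, h₂.2, ht]

end TestCurves

/-! ### §2 `ρ` test hypersurfaces determine the curve classes of an abelian variety -/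

section TestHypersurfaces

variable {q : ℕ}

/-- **`ρ(X)` TEST HYPERSURFACES.** On an abelian variety `X` of dimension `g = q + 1` there are irreducible
analytic hypersurfaces `D₁, …, D_ρ`, `ρ = dim_ℚ H^{2g-2}_Hodge(X) = dim_ℚ H²_Hodge(X)`, such that every Hodge
class `y ∈ H^{2g-2}_Hodge(X)` with `∫_{D_k} y = 0` for all `k` is `0` (Lefschetz `(1,1)` in cycle form:
`H²_Hodge` is spanned by the irreducible hypersurface classes; perfect pairing).
[cite: Fulton1998, §19.3.1 and Example 19.3.3] [cite: Lange2023AbelianVarietiesComplex, §6.2.5 Exercise (10) and §7.3.3 Exercise (2)(a)] -/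
theorem IsAbelianVariety.exists_testHypersurfaces (hX : IsAbelianVariety Φ) (e : Fin (2 * g) ≃ ι)
    (hq : q + 1 = g) :
    ∃ (κ : Type u) (_ : Fintype κ) (D : κ → Set (ComplexTorus Φ)) (hD : ∀ k, HasPureDim 𝓘(ℂ, E) (D k) q),
      Fintype.card κ = finrank ℚ (hodgeClasses Φ q) ∧ (∀ k, IsIrreducibleAnalyticSet 𝓘(ℂ, E) (D k)) ∧
        ∀ y ∈ hodgeClasses Φ q, (∀ k, analyticCyclePeriod Φ (hD k) y = 0) → y = 0 := by
  obtain ⟨η, hη⟩ := hX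
  exact hη.exists_fintype_forall_analyticCyclePeriod_eq_zero_imp Φ e hq (by omega)
    (IsAbelianVariety.analyticClasses_one_eq_hodgeClasses Φ e ⟨η, hη⟩)

omit [DecidableEq ι] [MeasurableSpace E] [BorelSpace E] in
/-- `ρ = dim_ℚ H²_Hodge(X)` form of the count (hard Lefschetz: `dim H^{2g-2}_Hodge = dim H²_Hodge`).
[cite: Lange2023AbelianVarietiesComplex, §7.3.2 (1)] -/
theorem IsAbelianVariety.finrank_hodgeClasses_eq_finrank_hodgeClasses_one (hX : IsAbelianVariety Φ)
    (e : Fin (2 * g) ≃ ι) (hq : q + 1 = g) : finrank ℚ (hodgeClasses Φ q) = finrank ℚ (hodgeClasses Φ 1) := by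
  obtain ⟨η, hη⟩ := hX
  exact hη.finrank_hodgeClasses_eq_of_add_eq Φ (by rw [finrank_eq_of_finTwoMulEquiv Φ e]; omega)

/-- **The class of a curve is determined by its intersection numbers with the `ρ` test hypersurfaces**:
`[C₁]_e = [C₂]_e ⟺ ∫_{D_k} [C₁]_e = ∫_{D_k} [C₂]_e` for `k = 1, …, ρ`.
[cite: Fulton1998, §19.3.1 and Example 19.3.3] [cite: Lange2023AbelianVarietiesComplex, §4.6.3 Thm. 4.6.14 (a) and §6.2.5 Exercise (10)] -/
theorem IsAbelianVariety.exists_testHypersurfaces_curve (hX : IsAbelianVariety Φ) (hq : q + 1 = g)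
    (hC' : 2 * 1 + 2 * q = 2 * g) :
    ∃ (κ : Type u) (_ : Fintype κ) (D : κ → Set (ComplexTorus Φ)) (hD : ∀ k, HasPureDim 𝓘(ℂ, E) (D k) q),
      Fintype.card κ = finrank ℚ (hodgeClasses Φ q) ∧ (∀ k, IsIrreducibleAnalyticSet 𝓘(ℂ, E) (D k)) ∧
        ∀ {C₁ C₂ : Set (ComplexTorus Φ)} (hC₁ : HasPureDim 𝓘(ℂ, E) C₁ 1) (hC₂ : HasPureDim 𝓘(ℂ, E) C₂ 1),
          analyticCycleClass Φ e hC' hC₁ = analyticCycleClass Φ e hC' hC₂ ↔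
            ∀ k, analyticCyclePeriod Φ (hD k) (analyticCycleClass Φ e hC' hC₁) =
              analyticCyclePeriod Φ (hD k) (analyticCycleClass Φ e hC' hC₂) := by
  obtain ⟨κ, _, D, hD, hcard, hDi, h⟩ := hX.exists_testHypersurfaces Φ e hq
  refine ⟨κ, inferInstance, D, hD, hcard, hDi, fun hC₁ hC₂ ↦ ⟨fun h12 k ↦ by rw [h12], fun h12 ↦ ?_⟩⟩
  rw [← sub_eq_zero]
  refine h _ (Submodule.sub_mem _
    (analyticClasses_le_hodgeClasses Φ e q (analyticCycleClass_mem_analyticClasses Φ e hC' hC₁))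
    (analyticClasses_le_hodgeClasses Φ e q (analyticCycleClass_mem_analyticClasses Φ e hC' hC₂))) fun k ↦ ?_
  rw [map_sub, h12 k, sub_self]

end TestHypersurfaces

end ComplexTorus

end Literature.Geometry.Kaehler

end
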